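import Mathlib
import HarnessLib
import Literature.MathematicalPhysics.QuantumManyBody.GroundState
import Summits.AtomisticToContinuum.BoseEinsteinCondensation.Theses.BECHeatBathGap

/-!
# Strategist census (stmt-AtomisticToContinuum-14367 `ParticleTensorisation`) — the Ψ₀ normal form

Scratch file backing `STRATEGY-CENSUS.md` §Strengthen / §Decomposition: the strengthened form
`GroundStateAT` (the AT clause for a genuine Dirichlet ground state, `IsGroundState`) and the
fixed-`N` transfer `WitnessRegularisation` (ground state with AT ⇒ `C¹` near-minimisers with AT at
every slack, constant doubled), with the kernel-checked composition
`GroundStateAT → WitnessRegularisation → ParticleTensorisation`.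

This is NOT registered as a line: `GroundStateAT` is crux-equivalent (converse by the landed
`ATClause.particleTensorisation_witness_limits` + Rellich compactness + `IsGroundState.of_tendstoL2`),
so the split relocates the crux; it is recorded so that future lines / disproofs may target the
canonical object `Ψ₀` directly, the regularisation half being provable infrastructure.
-/

noncomputable section

namespace Summit.AtomisticToContinuum.BoseEinsteinCondensation.Cruxes.ParticleTensorisation.Census

open MeasureTheory Filter Function
open scoped ENNReal
open Literature.MathematicalPhysics.QuantumManyBody.BoseGas

/-- The crux's division-free approximate-tensorisation clause for an amplitude `Θ` on `Λ_L^N`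
with constant `C` (verbatim the clause of `ParticleTensorisation`, abstracted in `Θ`). -/
def ATClauseOn (N : ℕ) (L C : ℝ) (Θ : Config N → ℂ) : Prop :=
  ∀ (F : (Fin N → EuclideanSpace ℝ (Fin 3)) → ℂ) (g : Fin N → (Fin N → EuclideanSpace ℝ (Fin 3)) → ℂ),
    Measurable F → (∀ i, Measurable (g i)) → (∃ M : ℝ, ∀ X, ‖F X‖ ≤ M ∧ ∀ i, ‖g i X‖ ≤ M) →
    (∀ i X x, g i (Function.update X i x) = g i X) →
    ∃ c : ℂ, (∫⁻ X in boxN N L, (‖F X - c * Θ X‖₊ : ℝ≥0∞) ^ 2) ≤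
      ENNReal.ofReal C * ∑ i : Fin N, ∫⁻ X in boxN N L, (‖F X - g i X * Θ X‖₊ : ℝ≥0∞) ^ 2

/-- **S⁺ (strengthened / canonical form of the crux).** Eventually in `N`, SOME Dirichlet ground
state `Ψ` (a minimiser of the closed form, `IsGroundState`) of `N` bosons in the box of side
`((N+1)/ρ)^{1/3}` satisfies the AT clause with an `N`-uniform constant. -/
def GroundStateAT : Prop :=
  ∀ v : ℝ → ℝ≥0∞, IsRepulsiveFiniteRange v → ∃ ρ₀ : ℝ, 0 < ρ₀ ∧ ∃ C : ℝ, 0 < C ∧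
    ∀ ρ : ℝ, 0 < ρ → ρ < ρ₀ → ∀ᶠ N : ℕ in atTop,
      ∃ Ψ : Config N → ℂ, IsGroundState v (sideLength ρ (N + 1)) Ψ ∧
        ATClauseOn N (sideLength ρ (N + 1)) C Ψ

/-- **Fixed-`N` witness regularisation.** A ground state whose Born law satisfies the AT clause
with constant `C` can be regularised, at every absolute slack `δ > 0`, into an admissible `C¹`
near-minimiser whose Born law satisfies the clause with constant `2C` (restriction of `|Ψ|²` to
configurations `ε`-away from walls / hard set, with conditional exit probabilities `≤ 1/(8CN)` for
`ε = ε(N, δ)` small, then a smooth cutoff in `[1/2, 1]` handled by the landed division-free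
Holley–Stroock `ATClause.clause_mul_of_clause`; `ε → 0` after `N` is what makes the constant
absolute). Provable in principle at fixed `N` (boundary regularity of `Ψ₀`), Lean-XL. -/
def WitnessRegularisation : Prop :=
  ∀ (N : ℕ) (L : ℝ) (v : ℝ → ℝ≥0∞), IsRepulsiveFiniteRange v → ∀ C : ℝ, 0 < C →
    ∀ Ψ : Config N → ℂ, IsGroundState v L Ψ → ATClauseOn N L C Ψ →
      ∀ δ : ℝ≥0∞, 0 < δ → ∃ Θ : TrialState N L,
        energy v Θ ≤ groundStateEnergy v N L + δ ∧ ATClauseOn N L (2 * C) Θ.ψ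

/-- The normal-form composition: `GroundStateAT → WitnessRegularisation → ParticleTensorisation`
(instantiation; the constant becomes `2C`). -/
theorem particleTensorisation_of_normalForm (h1 : GroundStateAT) (h2 : WitnessRegularisation) :
    Summit.AtomisticToContinuum.BoseEinsteinCondensation.Theses.BECHeatBathGap.ParticleTensorisation := by
  intro v hv
  obtain ⟨ρ₀, hρ₀, C, hC, H⟩ := h1 v hv
  refine ⟨ρ₀, hρ₀, 2 * C, by positivity, fun ρ hρ hρlt => ?_⟩
  filter_upwards [H ρ hρ hρlt] with N hN
  intro δ hδ
  obtain ⟨Ψ, hΨ, hAT⟩ := hN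
  obtain ⟨Θ, hE, hΘ⟩ := h2 N (sideLength ρ (N + 1)) v hv C hC Ψ hΨ hAT δ hδ
  exact ⟨Θ, hE, hΘ⟩

end Summit.AtomisticToContinuum.BoseEinsteinCondensation.Cruxes.ParticleTensorisation.Census
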